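import Literature.NumberTheory.LFunctions.Zhang2022.RepairSmoothTrueBand
import Literature.NumberTheory.LFunctions.Zhang2022.KnifeEdgeDiscWeightScale
import Literature.NumberTheory.LFunctions.Zhang2022.KnifeEdgeSlotCalculus

/-!
# Zhang (2022) §18-margin repair rung — barrier extension `R⁺⁺`: the E-004 true-band slot REDUCED to a
# weighted large-sieve-type slot for the sampled-zero family (diagonal scale, loss `𝓛^κ`, any `κ < 6`)

Trunk T-ANT (NumberTheory/LFunctions). Y. Zhang, *Discrete mean estimates and the Landau–Siegel
zero*, arXiv:2211.02515v1 (2022) [Zhang2022LandauSiegel] — **an unrefereed manuscript under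
adjudication. WHAT THIS IS NOT: nothing here asserts or denies its Theorems 1–2 or any analytic lemma;
no claim about Landau–Siegel zeros, about Parity, or about a repaired `Margin232` is made; `BandMeanValue` below is an
E*-SLOT (hypothesis shape, kind (c)), displayed where used, NEVER asserted; `Prop71`, `Lemma81`, `Prop22i`, `Lemma23` are
CLAIMS OF THE MANUSCRIPT (displayed nodes), never asserted.** Cell `landau-siegel` (rung F-S3), sub-cell E, seat
ls-barrier-p2 g3.

## What is proved (kernel)

The one displayed slot of the smooth wall-zero rows of the class of record is E-004 in its final form
`Repair.DiscMeanTrueBand c′ m η` (p470415; glued twin `DiscMeanTrueBandKM`, p471890): «inside the TRUE band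
`⌈P⌉ ≤ N ≤ ⌈D·P·𝓛^m⌉+1` the discrete mean of a wall-zero smooth profile moves by at most `η·(discMeanAbs⌈P⌉ + 𝔞𝔓)`».
That sentence is about PROFILES. This file reduces it to a sentence about the SAMPLED-ZERO FAMILY AS A MEASURE — a weighted
large-sieve-type inequality for band-supported Dirichlet polynomials with ARBITRARY coefficients at the diagonal scale:

* `BandMeanValue c′ m κ` (E-004′(κ), kind (c), NOT asserted): for all large `D`, under the displayed (b) `Re ρ = ½`, for
  every coefficient sequence `a : ℕ → ℂ` and every `⌈P⌉ ≤ N ≤ ⌈D·P·𝓛^m⌉ + 1`,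
  `Σ_{(ψ,ρ)} |Re 𝔠*(ρ,ψ)·Re ω(ρ)| · |Σ_{⌈P⌉ ≤ n < N} χψ(n) a(n) n^{−ρ}|² ≤ 𝓛^κ · discWeight · Σ_{⌈P⌉ ≤ n < N} |a(n)|²/n`
  — «the sampled family's weighted large-sieve constant at band lengths is at most `𝓛^κ` times the trivial (diagonal)
  one». (`discWeight = Σ|Re𝔠*·Reω|`, p455670.)
* `abs_discMean_sub_le_coefBlockMean` (deterministic, Cauchy–Schwarz in `ε`-form): for `1 ≤ M ≤ N` and every `η > 0`,
  `|discMean(N) − discMean(M)| ≤ η·discMeanAbs(M) + (1 + 1/η)·coefBlockMean(M,N)`, and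
  `discMeanAbs_le_two_mul_add_coefBlockMean`: `discMeanAbs(N) ≤ 2·discMeanAbs(M) + 2·coefBlockMean(M,N)` (REF-E E-22 N1:
  the band-edge term `discMeanAbs(bandEdge)` is controlled by the wall term plus the band block — there is no
  «`‖g‖∞²·discWeight`» bound, the length enters).
* `coefBlockMass_profCoef_le` (geometry of the class): a profile `K`-Lipschitz on `[1,∞)` with `g(1) = 0` has band mass
  `Σ_{⌈P⌉ ≤ n < N} |g(log n/log P)|²/n ≤ K²·(m+3)³·𝓛^{−15}` for every `N ≤ ⌈D·P·𝓛^m⌉ + 1`, eventually (band height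
  `≤ K·(log N/log P − 1) ≤ K(m+2)𝓛⁻⁸`, harmonic sum `≤ (m+3)𝓛`).
* **THE REDUCTION** `discMeanTrueBandAOn_wallZeroLip_of_bandMeanValue`: for every `κ < 6`, every `m`, every `K` and every
  `η > 0`: `BandMeanValue c′ m κ → Prop71 c′ → Lemma81 c′ → Prop22i → Lemma23 c′ → DiscMeanTrueBandAOn (WallZeroLip K) c′ m η`,
  where `DiscMeanTrueBandAOn` is the true-band slot with Assumption (A) displayed as a binder (the units lemma
  `discWeight ≤ 3𝓛⁹𝔓`, p467613, and `𝔞 ≥ a₀`, `frakALowerBound_holds`, are (A)-world statements) and `WallZeroLip K` =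
  «`K`-Lipschitz on `[1,∞)`, `g(1) = 0`» ⊇ both classes of record. Arithmetic: `𝓛^κ · 3𝓛⁹𝔓 · K²(m+3)³𝓛^{−15}
  = 3K²(m+3)³·𝓛^{κ−6}·𝔓 ≤ (3K²(m+3)³/a₀)·𝓛^{κ−6}·𝔞𝔓 → 0`. Corollaries `discMeanTrueBandA_of_bandMeanValue` (class of
  p470415) and `discMeanTrueBandAKM_of_bandMeanValue` (glued class of p471890); `DiscMeanTrueBandOn.toA` (the slot of
  record implies its (A)-form).

READING (BARRIER-STATE §2′ N1): the E-004 seam of the smooth wall-zero rows = the question «is the weighted large-sieve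
constant of the sampled family `{(ψ, ρ)}` at lengths `N ≤ D·P·𝓛^m` smaller than `𝓛⁶ ×` trivial?». ROOM = `𝓛⁶` exactly
matches the theory custodian's «safe iff `𝔞 ≫ 𝓛^{−5.9}`» (2026-08-26T11:35:37Z). PRICE (desk, ls-barrier-p2 g2
2026-08-26T22:24:30Z): the generic multiplicative large sieve embeds the thin prime window `(P, P(1+𝓛⁻⁶⁸))` into all
moduli `≤ 2P` and loses `𝓛^{77}` (`κ ≈ 77`, useless); the manuscript's mean-value formula I (Prop 7.1 / Lemma 8.1: exact
`ψ`-orthogonality) gives `κ = 0` but only for supports below `(7.2)`'s `P/T²`; band supports need its extension across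
the wall (reflected contour) — derivation-OPEN, an E*-len-type input in UPPER-BOUND form. Nothing here changes that price;
it makes the ROOM a kernel number. **v2/v3 (same seat, same day):** Part 6 adds the CLASS-RESTRICTED slots
`BandMeanValueOn 𝒞 c′ m κ` and `BandMeanValueLip c′ K m κ` = `BandMeanValueOn (profCoefClass K)` (E-004″: the inequality
for the class's own coefficient sequences only — the logically WEAKEST premise that still gives the reduction, hence the
recommended slot of record for rows), and re-proves the reduction from `BandMeanValueOn 𝒞` for every class
`𝒞 ⊇ profCoefClass K` (`discMeanTrueBandAOn_wallZeroLip_of_bandMeanValueOn`). v3 ERRATUM: the v2 «MODEL CAVEAT» claiming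
the all-coefficients slot to be model-false was WRONG (it ignored the principal-character projection: by orthogonality
`Σ_{ψ≠ψ₀ mod p}|Σ c_nψ(n)|² = (p−1)·Σ_r |A_r − Ā|²`, a VARIANCE over residue classes); the corrected model bookkeeping
gives loss `O(1)` for `D`-periodic, globally phase-aligned, flat and profile coefficients alike, large losses ONLY for
sequences phase-aligned inside the classes of ONE modulus (`≲ D𝓛^{m−400}` for that prime, diluted by `𝓛^{77}/P` in the
family) — so E-004′ and E-004″ are BOTH expected true in the model (DESK-MODEL; toy check with exact orthogonality mod 211
in the seat's folder). **v4:** Part 7 proves the ROOM is sharp for the method: for the wall tent the `κ = 6` right-hand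
side is `≥ 𝔓/8` under the units nodes and (A) (`bandMeanValue_rhs_at_six_ge`; band mass `≥ 𝓛^{−15}/16`,
`coefBlockMass_wallTent_ge`).

CURRENCY (REF-E C3(e)): discrete mean over the sampled zeros; (b) `Re ρ = ½`, (c) `BandMeanValue`, the four nodes and (A)
displayed.

## References

* Y. Zhang, arXiv:2211.02515v1 (2022), §2 (2.14)–(2.20), (2.30)–(2.31), Lemma 2.3, Prop. 2.2; §5 Lemma 5.7; §7 Prop 7.1,
  (7.2) [p. 44]; §8 Lemma 8.1. [cite: Zhang2022LandauSiegel, §§2, 5, 7, 8]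
* H. Iwaniec, E. Kowalski, *Analytic Number Theory*, AMS Colloquium Publ. 53 (2004), Thm 7.13 (the multiplicative
  large sieve). [cite: IwaniecKowalski2004, Thm 7.13]
* H. L. Montgomery, R. C. Vaughan, *Multiplicative Number Theory I*, CUP 2007, Thm 9.18 (Pólya–Vinogradov).
  [cite: MontgomeryVaughan2007, Thm 9.18]
  (v5 cite erratum: the large-sieve tags of v1–v4 pointed at Montgomery–Vaughan I, which has no Thm 7.13 — courtesy
  zl-lit-2 g4, pub/zhang-l/lit/CITE-CHECKS.md.)
-/

noncomputable section

open Real Complex Finset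
open scoped NNReal

namespace Literature.NumberTheory.LFunctions.Zhang2022

namespace Repair

open Skeleton

/-! ### Part 1 — block vocabulary (general coefficients) -/

section Vocabulary

variable {D : ℕ}

/-- The block `[M, N)` of a Dirichlet polynomial with GENERAL coefficients `a`, twisted by `χψ`:
`B(a; M, N; ψ, s) = Σ_{M ≤ n < N} χψ(n)·a(n)·n^{−s}`. [cite: Zhang2022LandauSiegel, §2 (2.23); §7 (7.2) p.44] -/
def coefBlock (χ : DirichletCharacter ℂ D) (x : Skeleton.Chr D) (a : ℕ → ℂ) (M N : ℕ) (s : ℂ) : ℂ :=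
  ∑ n ∈ Finset.Ico M N, Skeleton.pc χ x n * a n * (n : ℂ) ^ (-s)

/-- The weighted discrete mean of the block with ABSOLUTE weights:
`Σ_{(ψ,ρ)} |Re 𝔠*(ρ,ψ)·Re ω(ρ)|·|B(a; M, N; ψ, ρ)|²`. [cite: Zhang2022LandauSiegel, §2 (2.16)–(2.20)] -/
def coefBlockMean (c' : ℝ) (χ : DirichletCharacter ℂ D) (a : ℕ → ℂ) (M N : ℕ) : ℝ :=
  ∑ i ∈ Skeleton.idx χ, |(Skeleton.cstar c' D i.1 i.2).re * (Skeleton.omegaW D i.2).re| *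
    ‖coefBlock χ i.1 a M N i.2‖ ^ 2

/-- The plain `ℓ²`-mass of the block at `Re s = ½`: `Σ_{M ≤ n < N} |a(n)|²/n` (the diagonal of a mean value on the
critical line). [cite: IwaniecKowalski2004, Thm 7.13] -/
def coefBlockMass (a : ℕ → ℂ) (M N : ℕ) : ℝ := ∑ n ∈ Finset.Ico M N, ‖a n‖ ^ 2 / n

/-- The coefficient sequence of a profile `g` at modulus `D`: `a(n) = g(log n / log P)`.
[cite: Zhang2022LandauSiegel, §2 (2.23); §7 (7.2) p.44] -/
def profCoef (D : ℕ) (g : ℝ → ℂ) (n : ℕ) : ℂ := g (Real.log n / Real.log (Skeleton.bigP D))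

/-- For the coefficient sequence of a profile, the general block IS the profile block `KnifeEdge.blockPoly` of
`KnifeEdgeSlotCalculus` (definitionally). [cite: Zhang2022LandauSiegel, §2 (2.23), (2.30)] -/
theorem coefBlock_profCoef (χ : DirichletCharacter ℂ D) (x : Skeleton.Chr D) (g : ℝ → ℂ) (M N : ℕ) (s : ℂ) :
    coefBlock χ x (profCoef D g) M N s = KnifeEdge.blockPoly χ x M N g s := rfl

/-- The profile polynomial of length `N` is the one of length `M ≤ N` plus the block `[M, N)` of its coefficient
sequence (`KnifeEdge.profPoly_eq_add_blockPoly` in the general-coefficient vocabulary). [cite: Zhang2022LandauSiegel, §2 (2.23)] -/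
theorem profPoly_eq_add_coefBlock (χ : DirichletCharacter ℂ D) (x : Skeleton.Chr D) (g : ℝ → ℂ) {M N : ℕ}
    (hM : 1 ≤ M) (hMN : M ≤ N) (s : ℂ) :
    profPoly χ x g N s = profPoly χ x g M s + coefBlock χ x (profCoef D g) M N s := by
  rw [coefBlock_profCoef]
  exact KnifeEdge.profPoly_eq_add_blockPoly χ x hM hMN g s

/-- `coefBlockMean ≥ 0`. [cite: Zhang2022LandauSiegel, §2 (2.16)] -/
theorem coefBlockMean_nonneg (c' : ℝ) (χ : DirichletCharacter ℂ D) (a : ℕ → ℂ) (M N : ℕ) :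
    0 ≤ coefBlockMean c' χ a M N :=
  Finset.sum_nonneg fun _ _ => mul_nonneg (abs_nonneg _) (sq_nonneg _)

/-- `coefBlockMass ≥ 0` (the `ℓ²` mass of the large sieve). [cite: IwaniecKowalski2004, Thm 7.13] -/
theorem coefBlockMass_nonneg (a : ℕ → ℂ) (M N : ℕ) : 0 ≤ coefBlockMass a M N :=
  Finset.sum_nonneg fun _ _ => div_nonneg (sq_nonneg _) (Nat.cast_nonneg _)

/-- `discMeanAbs ≥ 0`. [cite: Zhang2022LandauSiegel, §2 (2.16)] -/
theorem discMeanAbs_nonneg (c' : ℝ) (χ : DirichletCharacter ℂ D) (g : ℝ → ℂ) (N : ℕ) :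
    0 ≤ discMeanAbs c' χ g N :=
  Finset.sum_nonneg fun _ _ => mul_nonneg (abs_nonneg _) (sq_nonneg _)

/-- `discWeight ≥ 0` (local copy of `Repair.discWeight_nonneg`, RepairFarBV.lean, to keep the import list short).
[cite: Zhang2022LandauSiegel, §2 (2.16)] -/
private theorem discWeight_nonneg_aux (c' : ℝ) (χ : DirichletCharacter ℂ D) : 0 ≤ discWeight c' χ :=
  Finset.sum_nonneg fun _ _ => abs_nonneg _

end Vocabulary

/-! ### Part 2 — deterministic: mean-square perturbation (Cauchy–Schwarz in `ε`-form) -/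

/-- `|‖a + t‖² − ‖a‖²| ≤ η‖a‖² + (1/η + 1)‖t‖²` for every `η > 0` (`2|Re(a t̄)| ≤ η‖a‖² + ‖t‖²/η`). [folklore] -/
private theorem abs_norm_add_sq_sub_norm_sq_le' (a t : ℂ) {η : ℝ} (hη : 0 < η) :
    |‖a + t‖ ^ 2 - ‖a‖ ^ 2| ≤ η * ‖a‖ ^ 2 + (1 / η + 1) * ‖t‖ ^ 2 := by
  have hid : ‖a + t‖ ^ 2 - ‖a‖ ^ 2 = 2 * (a * (starRingEnd ℂ) t).re + ‖t‖ ^ 2 := by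
    rw [Complex.sq_norm, Complex.sq_norm, Complex.sq_norm, Complex.normSq_add]
    ring
  have hre : |(a * (starRingEnd ℂ) t).re| ≤ ‖a‖ * ‖t‖ := by
    calc |(a * (starRingEnd ℂ) t).re| ≤ ‖a * (starRingEnd ℂ) t‖ := Complex.abs_re_le_norm _
      _ = ‖a‖ * ‖t‖ := by rw [norm_mul, Complex.norm_conj]
  have hamgm : 2 * (‖a‖ * ‖t‖) ≤ η * ‖a‖ ^ 2 + ‖t‖ ^ 2 / η := by
    have h0 : 0 ≤ (η * ‖a‖ - ‖t‖) ^ 2 / η := div_nonneg (sq_nonneg _) hη.le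
    have h1 : (η * ‖a‖ - ‖t‖) ^ 2 / η = η * ‖a‖ ^ 2 + ‖t‖ ^ 2 / η - 2 * (‖a‖ * ‖t‖) := by
      field_simp
      ring
    linarith
  have h2 := abs_le.mp hre
  have hdiv : (1 / η + 1) * ‖t‖ ^ 2 = ‖t‖ ^ 2 / η + ‖t‖ ^ 2 := by ring
  rw [hid, hdiv, abs_le]
  constructor <;> nlinarith [sq_nonneg ‖t‖, h2.1, h2.2, hamgm]

/-- **Mean-square perturbation of a weighted discrete mean** (deterministic): for every `η > 0`,
`|Σ w_i (‖a_i + t_i‖² − ‖a_i‖²)| ≤ η·Σ|w_i|‖a_i‖² + (1/η + 1)·Σ|w_i|‖t_i‖²` — the perturbation enters through its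
WEIGHTED MEAN SQUARE only (compare `KnifeEdgeInvisibleTail.abs_sum_mul_norm_sq_perturb_le`, which uses a sup bound).
[cite: Zhang2022LandauSiegel, §8 Lemma 8.1] -/
theorem abs_sum_mul_norm_sq_perturb_le_meanSq {ι : Type*} (s : Finset ι) (w : ι → ℝ) (a t : ι → ℂ)
    {η : ℝ} (hη : 0 < η) :
    |∑ i ∈ s, w i * (‖a i + t i‖ ^ 2 - ‖a i‖ ^ 2)| ≤
      η * ∑ i ∈ s, |w i| * ‖a i‖ ^ 2 + (1 / η + 1) * ∑ i ∈ s, |w i| * ‖t i‖ ^ 2 := by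
  calc |∑ i ∈ s, w i * (‖a i + t i‖ ^ 2 - ‖a i‖ ^ 2)|
      ≤ ∑ i ∈ s, |w i * (‖a i + t i‖ ^ 2 - ‖a i‖ ^ 2)| := abs_sum_le_sum_abs _ _
    _ ≤ ∑ i ∈ s, |w i| * (η * ‖a i‖ ^ 2 + (1 / η + 1) * ‖t i‖ ^ 2) := by
        refine sum_le_sum fun i _ => ?_
        rw [abs_mul]
        exact mul_le_mul_of_nonneg_left (abs_norm_add_sq_sub_norm_sq_le' (a i) (t i) hη) (abs_nonneg _)
    _ = η * ∑ i ∈ s, |w i| * ‖a i‖ ^ 2 + (1 / η + 1) * ∑ i ∈ s, |w i| * ‖t i‖ ^ 2 := by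
        rw [mul_sum, mul_sum, ← sum_add_distrib]
        exact sum_congr rfl fun i _ => by ring

/-- `Σ|w_i|‖a_i + t_i‖² ≤ 2Σ|w_i|‖a_i‖² + 2Σ|w_i|‖t_i‖²` (parallelogram bound). [folklore] -/
private theorem sum_abs_mul_norm_add_sq_le {ι : Type*} (s : Finset ι) (w : ι → ℝ) (a t : ι → ℂ) :
    ∑ i ∈ s, |w i| * ‖a i + t i‖ ^ 2 ≤
      2 * ∑ i ∈ s, |w i| * ‖a i‖ ^ 2 + 2 * ∑ i ∈ s, |w i| * ‖t i‖ ^ 2 := by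
  rw [mul_sum, mul_sum, ← sum_add_distrib]
  refine sum_le_sum fun i _ => ?_
  have h : ‖a i + t i‖ ^ 2 ≤ 2 * ‖a i‖ ^ 2 + 2 * ‖t i‖ ^ 2 := by
    have h1 : ‖a i + t i‖ ≤ ‖a i‖ + ‖t i‖ := norm_add_le _ _
    have h2 : 0 ≤ ‖a i + t i‖ := norm_nonneg _
    nlinarith [sq_nonneg (‖a i‖ - ‖t i‖), norm_nonneg (a i), norm_nonneg (t i)]
  calc |w i| * ‖a i + t i‖ ^ 2 ≤ |w i| * (2 * ‖a i‖ ^ 2 + 2 * ‖t i‖ ^ 2) :=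
        mul_le_mul_of_nonneg_left h (abs_nonneg _)
    _ = 2 * (|w i| * ‖a i‖ ^ 2) + 2 * (|w i| * ‖t i‖ ^ 2) := by ring

section DiscMeanBlock

variable {D : ℕ}

/-- **The discrete mean moves by at most `η·discMeanAbs(M) + (1 + 1/η)·coefBlockMean(M, N)`** (`1 ≤ M ≤ N`, any `η > 0`):
the band block enters ONLY through its weighted mean square. [cite: Zhang2022LandauSiegel, §2 (2.16)–(2.20); §8 Lemma 8.1] -/
theorem abs_discMean_sub_le_coefBlockMean (c' : ℝ) (χ : DirichletCharacter ℂ D) (g : ℝ → ℂ) {M N : ℕ}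
    (hM : 1 ≤ M) (hMN : M ≤ N) {η : ℝ} (hη : 0 < η) :
    |discMean c' χ g N - discMean c' χ g M| ≤
      η * discMeanAbs c' χ g M + (1 / η + 1) * coefBlockMean c' χ (profCoef D g) M N := by
  have hdiff : discMean c' χ g N - discMean c' χ g M =
      ∑ i ∈ Skeleton.idx χ, (cstar c' D i.1 i.2).re * (omegaW D i.2).re *
        (‖profPoly χ i.1 g M i.2 + coefBlock χ i.1 (profCoef D g) M N i.2‖ ^ 2 -
          ‖profPoly χ i.1 g M i.2‖ ^ 2) := by
    simp only [discMean]
    rw [← Finset.sum_sub_distrib]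
    refine Finset.sum_congr rfl fun i _ => ?_
    rw [profPoly_eq_add_coefBlock χ i.1 g hM hMN]
    ring
  rw [hdiff]
  exact abs_sum_mul_norm_sq_perturb_le_meanSq (Skeleton.idx χ)
    (fun i : ((_ : Chr D) × ℂ) => (cstar c' D i.1 i.2).re * (omegaW D i.2).re)
    (fun i : ((_ : Chr D) × ℂ) => profPoly χ i.1 g M i.2)
    (fun i : ((_ : Chr D) × ℂ) => coefBlock χ i.1 (profCoef D g) M N i.2) hη

/-- **`discMeanAbs(N) ≤ 2·discMeanAbs(M) + 2·coefBlockMean(M, N)`** (`1 ≤ M ≤ N`): the absolute mean at a longer length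
is controlled by the one at `M` plus the block's weighted mean square (the length enters through the block; there is
no length-free «`‖g‖∞²·discWeight`» bound). [cite: Zhang2022LandauSiegel, §2 (2.16)–(2.20)] -/
theorem discMeanAbs_le_two_mul_add_coefBlockMean (c' : ℝ) (χ : DirichletCharacter ℂ D) (g : ℝ → ℂ) {M N : ℕ}
    (hM : 1 ≤ M) (hMN : M ≤ N) :
    discMeanAbs c' χ g N ≤ 2 * discMeanAbs c' χ g M + 2 * coefBlockMean c' χ (profCoef D g) M N := by
  have h : discMeanAbs c' χ g N =
      ∑ i ∈ Skeleton.idx χ, |(cstar c' D i.1 i.2).re * (omegaW D i.2).re| *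
        ‖profPoly χ i.1 g M i.2 + coefBlock χ i.1 (profCoef D g) M N i.2‖ ^ 2 := by
    simp only [discMeanAbs]
    refine Finset.sum_congr rfl fun i _ => ?_
    rw [profPoly_eq_add_coefBlock χ i.1 g hM hMN]
  rw [h]
  exact sum_abs_mul_norm_add_sq_le (Skeleton.idx χ)
    (fun i : ((_ : Chr D) × ℂ) => (cstar c' D i.1 i.2).re * (omegaW D i.2).re)
    (fun i : ((_ : Chr D) × ℂ) => profPoly χ i.1 g M i.2)
    (fun i : ((_ : Chr D) × ℂ) => coefBlock χ i.1 (profCoef D g) M N i.2)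

end DiscMeanBlock

/-! ### Part 3 — the slots: E-004′(κ) `BandMeanValue` and the (A)-form of the true-band slot -/

/-- **E-004′(κ) — WEIGHTED LARGE-SIEVE-TYPE SLOT FOR THE SAMPLED FAMILY AT BAND LENGTHS** (hypothesis shape, kind (c);
NOT asserted): for all large `D`, every real primitive `χ (mod D)`, IF every sampled zero has `Re ρ = ½` (displayed (b)),
then for EVERY coefficient sequence `a : ℕ → ℂ` and every length `⌈P⌉ ≤ N ≤ ⌈D·P·𝓛^m⌉ + 1`,
`Σ_{(ψ,ρ)} |Re𝔠*(ρ,ψ)·Reω(ρ)|·|Σ_{⌈P⌉≤n<N} χψ(n)a(n)n^{−ρ}|² ≤ 𝓛^κ · discWeight · Σ_{⌈P⌉≤n<N} |a(n)|²/n` — the family's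
weighted large-sieve constant at band lengths is at most `𝓛^κ` times the diagonal (trivial) one. In print: the generic
multiplicative large sieve [IwaniecKowalski2004, Thm 7.13] gives this shape only after embedding the thin prime window in
all moduli `≤ 2P` (loss `𝓛^{77}`); the manuscript's formula I (Prop 7.1) is the `κ = 0` statement for supports `< P/T²`.
**MODEL NOTE (v3; DESK-MODEL, not a kernel statement; supersedes the withdrawn v2 caveat): in the (Gaussian t-average of
width `𝓛₂`) × (exact `ψ`-orthogonality mod `p`) model of the sampled mean, the per-prime quantity is `(p−1)` times the
VARIANCE `Σ_r |A_r − Ā|²` of the class sums `A_r = Σ_{n≡r (p)} a(n)χ(n)n^{−1/2−it}`; every `r`-independent component is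
projected out. Flat, `D`-periodic (`1_{n≡r₀ (D)}`), globally phase-aligned (`χ(n)n^{iT₀}`) and profile coefficients all have
loss `O(1)`; only sequences phase-aligned inside the classes of ONE modulus lose (`≲ D𝓛^{m−400}` for that prime), and one
prime is a `𝓛^{77}/P` share of the family. So this all-coefficients slot is EXPECTED TRUE in the model; no in-print tool
proves it (generic large sieve: loss `𝓛^{77}` on the thin window). The class-restricted `BandMeanValueLip` (Part 6) is the
logically weaker premise and the recommended slot of record for rows.**
[cite: Zhang2022LandauSiegel, §2 (2.14)–(2.16); §7 Prop 7.1, (7.2)] -/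
def BandMeanValue (c' : ℝ) (m : ℕ) (κ : ℝ) : Prop :=
  Skeleton.ForAllLarge fun D _ χ =>
    (∀ i ∈ Skeleton.idx χ, (i.2).re = 1 / 2) →
      ∀ a : ℕ → ℂ, ∀ N : ℕ, ⌈Skeleton.bigP D⌉₊ ≤ N → N ≤ bandEdge D m →
        coefBlockMean c' χ a ⌈Skeleton.bigP D⌉₊ N ≤
          Skeleton.ell D ^ κ * discWeight c' χ * coefBlockMass a ⌈Skeleton.bigP D⌉₊ N

/-- `bandEdge` is monotone in `m` once `𝓛 ≥ 1`. [cite: Zhang2022LandauSiegel, §2 (2.30)] -/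
theorem bandEdge_mono {D : ℕ} (hD : 3 ≤ D) {m m' : ℕ} (h : m ≤ m') : bandEdge D m ≤ bandEdge D m' := by
  unfold bandEdge
  have hℓ1 : 1 ≤ Skeleton.ell D := (Skeleton.one_lt_ell hD).le
  have hP : 0 ≤ Skeleton.bigP D := (Real.exp_pos _).le
  have hD0 : (0 : ℝ) ≤ D := Nat.cast_nonneg _
  refine Nat.succ_le_succ (Nat.ceil_mono ?_)
  exact mul_le_mul_of_nonneg_left (pow_le_pow_right₀ hℓ1 h) (mul_nonneg hD0 hP)

/-- E-004′ is antitone in the band exponent `m` (a longer band is a stronger slot) and monotone in the loss `κ`.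
[cite: Zhang2022LandauSiegel, §2 (2.30)] -/
theorem BandMeanValue.mono {c' : ℝ} {m m' : ℕ} {κ κ' : ℝ} (hm : m' ≤ m) (hκ : κ ≤ κ')
    (h : BandMeanValue c' m κ) : BandMeanValue c' m' κ' := by
  refine (h.and (Skeleton.ForAllLarge.of_le 3 fun D _ _ hD _ _ => hD)).mono ?_
  intro D _ χ _ _ hh hb a N hN₁ hN₂
  obtain ⟨hB, hD3⟩ := hh
  have hℓ1 : 1 ≤ Skeleton.ell D := (Skeleton.one_lt_ell hD3).le
  have h1 := hB hb a N hN₁ (hN₂.trans (bandEdge_mono hD3 hm))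
  refine h1.trans (mul_le_mul_of_nonneg_right (mul_le_mul_of_nonneg_right
    (Real.rpow_le_rpow_of_exponent_le hℓ1 hκ) (discWeight_nonneg_aux c' χ)) (coefBlockMass_nonneg _ _ _))

/-- **E-004 on the true band WITH ASSUMPTION (A) DISPLAYED**, over a profile class `V` (hypothesis shape; NOT asserted):
the slot `DiscMeanTrueBandOn V c′ m η` of p470415 with the extra binder `AssumptionA D χ` (the standing assumption of the
endgame; the units lemma and `𝔞 ≥ a₀` are (A)-world statements). [cite: Zhang2022LandauSiegel, §2 (2.16)–(2.20), (2.30)–(2.31)] -/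
def DiscMeanTrueBandAOn (V : (ℝ → ℂ) → Prop) (c' : ℝ) (m : ℕ) (η : ℝ) : Prop :=
  Skeleton.ForAllLarge fun D _ χ => Skeleton.AssumptionA D χ →
    (∀ i ∈ Skeleton.idx χ, (i.2).re = 1 / 2) →
      ∀ g : ℝ → ℂ, V g → ∀ N : ℕ, ⌈Skeleton.bigP D⌉₊ ≤ N → N ≤ bandEdge D m →
        |discMean c' χ g N - discMean c' χ g ⌈Skeleton.bigP D⌉₊| ≤
          η * (discMeanAbs c' χ g ⌈Skeleton.bigP D⌉₊ + Skeleton.frakA χ * frakP D)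

/-- The (A)-form of the slot of record `DiscMeanTrueBand` (wall-value-zero class: globally 1-Lipschitz, `‖g‖ ≤ 1`,
`g(1) = 0`). [cite: Zhang2022LandauSiegel, §2 (2.16)–(2.20), (2.30)–(2.31)] -/
def DiscMeanTrueBandA (c' : ℝ) (m : ℕ) (η : ℝ) : Prop :=
  DiscMeanTrueBandAOn (fun g => LipschitzWith 1 g ∧ (∀ z, ‖g z‖ ≤ 1) ∧ g 1 = 0) c' m η

/-- The (A)-form of the glued slot `DiscMeanTrueBandKM` (class `GluedWallZeroClass K M`, p471890).
[cite: Zhang2022LandauSiegel, §2 (2.16)–(2.20), (2.30)–(2.31)] -/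
def DiscMeanTrueBandAKM (c' : ℝ) (K : ℝ≥0) (M : ℝ) (m : ℕ) (η : ℝ) : Prop :=
  DiscMeanTrueBandAOn (GluedWallZeroClass K M) c' m η

/-- The (A)-form is antitone in the class. [cite: Zhang2022LandauSiegel, §2 (2.16)–(2.20)] -/
theorem DiscMeanTrueBandAOn.anti {V V' : (ℝ → ℂ) → Prop} {c' : ℝ} {m : ℕ} {η : ℝ} (hVV : ∀ g, V g → V' g)
    (h : DiscMeanTrueBandAOn V' c' m η) : DiscMeanTrueBandAOn V c' m η :=
  Skeleton.ForAllLarge.mono h fun _ _ _ _ _ hB hA hb g hg => hB hA hb g (hVV g hg)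

/-- The slot of record implies its (A)-form (one binder more). [cite: Zhang2022LandauSiegel, §2 (2.16)–(2.20)] -/
theorem DiscMeanTrueBandOn.toA {V : (ℝ → ℂ) → Prop} {c' : ℝ} {m : ℕ} {η : ℝ} (h : DiscMeanTrueBandOn V c' m η) :
    DiscMeanTrueBandAOn V c' m η :=
  Skeleton.ForAllLarge.mono h fun _ _ _ _ _ hB _ hb g hg => hB hb g hg

/-- The wall-zero Lipschitz class on `[1, ∞)` with constant `K`: `K`-Lipschitz on `[1, ∞)` and `g(1) = 0`; nothing is
asked below the wall and NO sup bound (the band mass needs none). [cite: Zhang2022LandauSiegel, §7 (7.2) p.44] -/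
def WallZeroLip (K : ℝ≥0) (g : ℝ → ℂ) : Prop := LipschitzOnWith K g (Set.Ici 1) ∧ g 1 = 0

/-- The wall-value-zero class of record is inside `WallZeroLip 1`. [cite: Zhang2022LandauSiegel, §7 (7.2) p.44] -/
theorem wallZeroLip_of_wallZero (g : ℝ → ℂ) (hg : LipschitzWith 1 g ∧ (∀ z, ‖g z‖ ≤ 1) ∧ g 1 = 0) :
    WallZeroLip 1 g :=
  ⟨hg.1.lipschitzOnWith, hg.2.2⟩

/-- The glued class `GluedWallZeroClass K M` is inside `WallZeroLip K`. [cite: Zhang2022LandauSiegel, §7 (7.2) p.44] -/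
theorem wallZeroLip_of_glued {K : ℝ≥0} {M : ℝ} (g : ℝ → ℂ) (hg : GluedWallZeroClass K M g) : WallZeroLip K g :=
  ⟨hg.1, hg.2.2⟩

/-! ### Part 4 — geometry of the class: the band mass of a wall-zero Lipschitz profile is `≲ 𝓛^{−15}` -/

/-- `Σ_{K < n ≤ N} 1/n ≤ log N − log K` for `1 ≤ K ≤ N` (`1/(n+1) ≤ log(n+1) − log n`). [folklore] -/
private theorem sum_Ico_inv_le_log {K : ℕ} (hK : 1 ≤ K) {N : ℕ} (hKN : K ≤ N) :
    ∑ n ∈ Finset.Ico (K + 1) (N + 1), (n : ℝ)⁻¹ ≤ Real.log N - Real.log K := by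
  induction N, hKN using Nat.le_induction with
  | base => simp
  | succ N hN ih =>
    rw [Finset.sum_Ico_succ_top (by omega), Nat.cast_succ]
    have hN0 : (0 : ℝ) < N := by exact_mod_cast lt_of_lt_of_le (Nat.lt_of_lt_of_le Nat.zero_lt_one hK) hN
    have hN1 : (0 : ℝ) < N + 1 := by linarith
    have h := Real.one_sub_inv_le_log_of_pos (div_pos hN1 hN0)
    rw [Real.log_div hN1.ne' hN0.ne', inv_div] at h
    have h2 : 1 - (N : ℝ) / (N + 1) = ((N : ℝ) + 1)⁻¹ := by field_simp; ring
    rw [h2] at h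
    linarith

/-- `log(bandEdge D m) ≤ log 2 + 𝓛 + 𝓛⁹ + m·log 𝓛` for `D ≥ 3` (`⌈D·P·𝓛^m⌉ + 1 ≤ 2·D·P·𝓛^m`).
[cite: Zhang2022LandauSiegel, §2 (2.6), (2.30)] -/
theorem log_bandEdge_le {D : ℕ} (hD : 3 ≤ D) (m : ℕ) :
    Real.log (bandEdge D m) ≤
      Real.log 2 + Skeleton.ell D + Skeleton.ell D ^ 9 + m * Real.log (Skeleton.ell D) := by
  have hℓ1 : 1 ≤ Skeleton.ell D := (Skeleton.one_lt_ell hD).le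
  have hℓ0 : 0 < Skeleton.ell D := by linarith
  have hD3 : (3 : ℝ) ≤ D := by exact_mod_cast hD
  have hP1 : 1 ≤ Skeleton.bigP D := by rw [Skeleton.bigP]; exact Real.one_le_exp (by positivity)
  have hP0 : 0 < Skeleton.bigP D := Real.exp_pos _
  set X : ℝ := (D : ℝ) * Skeleton.bigP D * Skeleton.ell D ^ m with hX
  have hX2 : 2 ≤ X := by
    have h1 : (1 : ℝ) ≤ Skeleton.ell D ^ m := one_le_pow₀ hℓ1
    calc (2 : ℝ) = 2 * 1 * 1 := by ring
      _ ≤ (D : ℝ) * Skeleton.bigP D * Skeleton.ell D ^ m :=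
          mul_le_mul (mul_le_mul (by linarith) hP1 zero_le_one (by linarith)) h1 zero_le_one
            (mul_nonneg (by linarith) hP0.le)
  have hX0 : 0 < X := by linarith
  have hbe : ((bandEdge D m : ℕ) : ℝ) ≤ 2 * X := by
    unfold bandEdge
    push_cast
    have := Nat.ceil_lt_add_one hX0.le
    rw [← hX]
    linarith
  have hbe0 : (0 : ℝ) < (bandEdge D m : ℕ) := by
    unfold bandEdge; push_cast; positivity
  calc Real.log (bandEdge D m) ≤ Real.log (2 * X) := Real.log_le_log hbe0 hbe
    _ = Real.log 2 + Real.log D + Real.log (Skeleton.bigP D) + m * Real.log (Skeleton.ell D) := by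
        rw [hX, Real.log_mul (by norm_num) hX0.ne', Real.log_mul (by positivity) (by positivity),
          Real.log_mul (by positivity) hP0.ne', Real.log_pow]
        ring
    _ = Real.log 2 + Skeleton.ell D + Skeleton.ell D ^ 9 + m * Real.log (Skeleton.ell D) := by
        rw [Skeleton.bigP, Real.log_exp, Skeleton.ell]

/-- **Band height**: a profile `K`-Lipschitz on `[1, ∞)` with `g(1) = 0` has `‖g(log n/log P)‖ ≤ K·(log n/log P − 1)` at
every `n ≥ P` (`D ≥ 3`). [cite: Zhang2022LandauSiegel, §7 (7.2) p.44] -/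
theorem norm_profCoef_le {D : ℕ} (hD : 3 ≤ D) {K : ℝ≥0} {g : ℝ → ℂ} (hg : WallZeroLip K g) {n : ℕ}
    (hn : Skeleton.bigP D ≤ n) :
    ‖profCoef D g n‖ ≤ K * (Real.log n / Real.log (Skeleton.bigP D) - 1) := by
  have hℓ0 : 0 < Skeleton.ell D := zero_lt_one.trans (Skeleton.one_lt_ell hD)
  have hP0 : 0 < Skeleton.bigP D := Real.exp_pos _
  have hlogP : 0 < Real.log (Skeleton.bigP D) := by rw [Skeleton.bigP, Real.log_exp]; positivity
  set z : ℝ := Real.log n / Real.log (Skeleton.bigP D) with hz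
  have hz1 : 1 ≤ z := by
    rw [hz, le_div_iff₀ hlogP, one_mul]
    exact Real.log_le_log hP0 hn
  have h := hg.1.dist_le_mul z (Set.mem_Ici.mpr hz1) 1 (Set.mem_Ici.mpr le_rfl)
  rw [hg.2, dist_zero_right, Real.dist_eq, abs_of_nonneg (by linarith)] at h
  simpa only [profCoef, ← hz] using h

/-- **THE BAND MASS OF THE CLASS** (eventually in `D`, uniformly in the profile and the length): for every `m` there is
`D₀` such that for `D ≥ D₀`, every `g ∈ WallZeroLip K` and every `⌈P⌉ ≤ N ≤ ⌈D·P·𝓛^m⌉ + 1`,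
`Σ_{⌈P⌉ ≤ n < N} |g(log n/log P)|²/n ≤ K²·(m+3)³·𝓛^{−15}` (height `≤ K(m+2)𝓛⁻⁸`, harmonic sum `≤ (m+3)𝓛`).
[cite: Zhang2022LandauSiegel, §2 (2.30); §7 (7.2) p.44] -/
theorem coefBlockMass_profCoef_le (m : ℕ) :
    Skeleton.ForAllLarge fun D _ _ => ∀ (K : ℝ≥0) (g : ℝ → ℂ), WallZeroLip K g →
      ∀ N : ℕ, ⌈Skeleton.bigP D⌉₊ ≤ N → N ≤ bandEdge D m →
        coefBlockMass (profCoef D g) ⌈Skeleton.bigP D⌉₊ N ≤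
          (K : ℝ) ^ 2 * ((m : ℝ) + 3) ^ 3 * (Skeleton.ell D ^ 15)⁻¹ := by
  refine Skeleton.ForAllLarge.of_le 3 fun D _ _ hD _ _ K g hg N hN₁ hN₂ => ?_
  have hℓ1 : 1 < Skeleton.ell D := Skeleton.one_lt_ell hD
  have hℓ0 : 0 < Skeleton.ell D := zero_lt_one.trans hℓ1
  have hP0 : 0 < Skeleton.bigP D := Real.exp_pos _
  have hlogP : Real.log (Skeleton.bigP D) = Skeleton.ell D ^ 9 := by rw [Skeleton.bigP, Real.log_exp]
  have hP2 : 2 ≤ Skeleton.bigP D := by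
    rw [Skeleton.bigP]
    have h1 : (1 : ℝ) ≤ Skeleton.ell D ^ 9 := one_le_pow₀ hℓ1.le
    have := Real.add_one_le_exp (Skeleton.ell D ^ 9)
    linarith
  have hlogℓ : Real.log (Skeleton.ell D) ≤ Skeleton.ell D := (Real.log_le_sub_one_of_pos hℓ0).trans (by linarith)
  have hlogℓ0 : 0 ≤ Real.log (Skeleton.ell D) := Real.log_nonneg hℓ1.le
  have hlog2 : Real.log 2 ≤ 1 := by
    have := Real.log_two_lt_d9; linarith
  have hm0 : (0 : ℝ) ≤ m := Nat.cast_nonneg _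
  -- height bound on the band: `z_n − 1 ≤ (m+2)·𝓛⁻⁸`
  set M₀ := ⌈Skeleton.bigP D⌉₊ with hM₀
  have hM₀1 : 1 ≤ M₀ := Nat.one_le_ceil_iff.mpr hP0
  have hheight : ∀ n ∈ Finset.Ico M₀ N,
      ‖profCoef D g n‖ ^ 2 ≤ (K : ℝ) ^ 2 * (((m : ℝ) + 2) * (Skeleton.ell D ^ 8)⁻¹) ^ 2 := by
    intro n hn
    have hn1 : M₀ ≤ n := (Finset.mem_Ico.mp hn).1
    have hn2 : n < N := (Finset.mem_Ico.mp hn).2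
    have hnP : Skeleton.bigP D ≤ n := (Nat.le_ceil _).trans (by exact_mod_cast hn1)
    have hn0 : (0 : ℝ) < n := hP0.trans_le hnP
    have h1 := norm_profCoef_le hD hg hnP
    have hz : Real.log n / Real.log (Skeleton.bigP D) - 1 ≤ ((m : ℝ) + 2) * (Skeleton.ell D ^ 8)⁻¹ := by
      rw [hlogP, div_sub_one (pow_ne_zero 9 hℓ0.ne'), div_le_iff₀ (pow_pos hℓ0 9)]
      have hnb : Real.log n ≤ Real.log (bandEdge D m) :=
        Real.log_le_log hn0 (by exact_mod_cast (hn2.le.trans hN₂))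
      have hb := log_bandEdge_le hD m
      have : ((m : ℝ) + 2) * (Skeleton.ell D ^ 8)⁻¹ * Skeleton.ell D ^ 9 = ((m : ℝ) + 2) * Skeleton.ell D := by
        field_simp
      rw [this]
      nlinarith [mul_le_mul_of_nonneg_left hlogℓ hm0]
    have hz0 : 0 ≤ Real.log n / Real.log (Skeleton.bigP D) - 1 := by
      rw [hlogP, sub_nonneg, le_div_iff₀ (pow_pos hℓ0 9), one_mul, ← hlogP]
      exact Real.log_le_log hP0 hnP
    have h2 : ‖profCoef D g n‖ ≤ (K : ℝ) * (((m : ℝ) + 2) * (Skeleton.ell D ^ 8)⁻¹) :=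
      h1.trans (mul_le_mul_of_nonneg_left hz (NNReal.coe_nonneg K))
    calc ‖profCoef D g n‖ ^ 2 ≤ ((K : ℝ) * (((m : ℝ) + 2) * (Skeleton.ell D ^ 8)⁻¹)) ^ 2 :=
          pow_le_pow_left₀ (norm_nonneg _) h2 2
      _ = (K : ℝ) ^ 2 * (((m : ℝ) + 2) * (Skeleton.ell D ^ 8)⁻¹) ^ 2 := by ring
  -- harmonic bound on the band: `Σ 1/n ≤ (m+3)·𝓛`
  have hharm : ∑ n ∈ Finset.Ico M₀ N, (n : ℝ)⁻¹ ≤ ((m : ℝ) + 3) * Skeleton.ell D := by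
    by_cases hMN : N ≤ M₀
    · rw [Finset.Ico_eq_empty (not_lt.mpr hMN), Finset.sum_empty]; positivity
    have hMN' : M₀ ≤ N := (not_le.mp hMN).le
    have hK1 : 1 ≤ M₀ - 1 := by
      have : (2 : ℝ) ≤ M₀ := hP2.trans (Nat.le_ceil _)
      have h2 : 2 ≤ M₀ := by exact_mod_cast this
      omega
    have hs : ∑ n ∈ Finset.Ico M₀ N, (n : ℝ)⁻¹ = ∑ n ∈ Finset.Ico (M₀ - 1 + 1) (N - 1 + 1), (n : ℝ)⁻¹ := by
      congr 1; congr 1 <;> omega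
    rw [hs]
    refine (sum_Ico_inv_le_log hK1 (by omega)).trans ?_
    have hNm1 : ((N - 1 : ℕ) : ℝ) ≤ (bandEdge D m : ℕ) := by exact_mod_cast (Nat.sub_le N 1).trans hN₂
    have hN10 : (0 : ℝ) < ((N - 1 : ℕ) : ℝ) := by
      have : 1 ≤ N - 1 := by omega
      exact_mod_cast this
    have hM1 : Skeleton.bigP D / 2 ≤ ((M₀ - 1 : ℕ) : ℝ) := by
      rw [Nat.cast_sub hM₀1, Nat.cast_one]
      have := Nat.le_ceil (Skeleton.bigP D)
      rw [← hM₀] at this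
      linarith
    have hM10 : 0 < Skeleton.bigP D / 2 := by linarith
    have hlogPhalf : Real.log (Skeleton.bigP D / 2) = Skeleton.ell D ^ 9 - Real.log 2 := by
      rw [Real.log_div hP0.ne' (by norm_num), hlogP]
    calc Real.log ((N - 1 : ℕ) : ℝ) - Real.log ((M₀ - 1 : ℕ) : ℝ)
        ≤ Real.log (bandEdge D m) - Real.log (Skeleton.bigP D / 2) :=
          sub_le_sub (Real.log_le_log hN10 hNm1) (Real.log_le_log hM10 hM1)
      _ ≤ (Real.log 2 + Skeleton.ell D + Skeleton.ell D ^ 9 + m * Real.log (Skeleton.ell D)) -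
            (Skeleton.ell D ^ 9 - Real.log 2) := by
          rw [hlogPhalf]
          exact sub_le_sub_right (log_bandEdge_le hD m) _
      _ = 2 * Real.log 2 + Skeleton.ell D + m * Real.log (Skeleton.ell D) := by ring
      _ ≤ ((m : ℝ) + 3) * Skeleton.ell D := by nlinarith [mul_le_mul_of_nonneg_left hlogℓ hm0]
  -- assemble
  have hsum : coefBlockMass (profCoef D g) M₀ N ≤
      ∑ n ∈ Finset.Ico M₀ N, (K : ℝ) ^ 2 * (((m : ℝ) + 2) * (Skeleton.ell D ^ 8)⁻¹) ^ 2 * (n : ℝ)⁻¹ := by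
    unfold coefBlockMass
    refine Finset.sum_le_sum fun n hn => ?_
    rw [div_eq_mul_inv]
    exact mul_le_mul_of_nonneg_right (hheight n hn) (inv_nonneg.mpr (Nat.cast_nonneg _))
  rw [← Finset.mul_sum] at hsum
  refine hsum.trans ?_
  have hc : (K : ℝ) ^ 2 * (((m : ℝ) + 2) * (Skeleton.ell D ^ 8)⁻¹) ^ 2 * (((m : ℝ) + 3) * Skeleton.ell D) ≤
      (K : ℝ) ^ 2 * ((m : ℝ) + 3) ^ 3 * (Skeleton.ell D ^ 15)⁻¹ := by
    have h1 : (K : ℝ) ^ 2 * (((m : ℝ) + 2) * (Skeleton.ell D ^ 8)⁻¹) ^ 2 * (((m : ℝ) + 3) * Skeleton.ell D) =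
        (K : ℝ) ^ 2 * (((m : ℝ) + 2) ^ 2 * ((m : ℝ) + 3)) * (Skeleton.ell D ^ 15)⁻¹ := by
      field_simp
    rw [h1]
    refine mul_le_mul_of_nonneg_right (mul_le_mul_of_nonneg_left ?_ (sq_nonneg _))
      (inv_nonneg.mpr (pow_nonneg hℓ0.le 15))
    nlinarith [sq_nonneg ((m : ℝ) + 2)]
  exact (mul_le_mul_of_nonneg_left hharm (by positivity)).trans hc

/-! ### Part 5 — THE REDUCTION: E-004′(κ), `κ < 6`, and the manuscript's nodes give E-004 (with (A) displayed) -/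

/-- Eventually `D ≥ 3` and `𝓛 ≥ L₀`, for any real `L₀` («`D` greater than a sufficiently large number», `𝓛 = log D`).
[cite: Zhang2022LandauSiegel, §2 (2.1) p. 4] -/
theorem forAllLarge_three_le_and_le_ell (L₀ : ℝ) :
    Skeleton.ForAllLarge fun D _ _ => 3 ≤ D ∧ L₀ ≤ Skeleton.ell D := by
  refine Skeleton.ForAllLarge.of_le (max 3 ⌈Real.exp L₀⌉₊) fun D _ _ hD _ _ => ?_
  have hD3 : 3 ≤ D := le_trans (le_max_left _ _) hD
  refine ⟨hD3, ?_⟩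
  have h : Real.exp L₀ ≤ (D : ℝ) := (Nat.le_ceil _).trans (by exact_mod_cast le_trans (le_max_right _ _) hD)
  exact (Real.le_log_iff_exp_le (lt_of_lt_of_le (Real.exp_pos _) h)).mpr h

/-- **The loss `𝓛^κ` against the room `𝓛⁶`**: for `κ < 6`, every `C` and every `ε > 0`, eventually
`C·𝓛^κ ≤ ε·𝓛⁶` (`𝓛 = log D → ∞`). [cite: Zhang2022LandauSiegel, §2 (2.1) p. 4] -/
theorem loss_le_room_eventually {κ : ℝ} (hκ : κ < 6) (C : ℝ) {ε : ℝ} (hε : 0 < ε) :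
    Skeleton.ForAllLarge fun D _ _ => C * Skeleton.ell D ^ κ ≤ ε * Skeleton.ell D ^ 6 := by
  have hgap : 0 < 6 - κ := by linarith
  set T : ℝ := max (C / ε) 1 with hT
  have hT1 : 1 ≤ T := le_max_right _ _
  have hT0 : 0 ≤ T := zero_le_one.trans hT1
  refine (forAllLarge_three_le_and_le_ell (T ^ (1 / (6 - κ)))).mono ?_
  intro D _ _ _ _ h
  obtain ⟨hD3, hL⟩ := h
  have hℓ1 : 1 < Skeleton.ell D := Skeleton.one_lt_ell hD3
  have hℓ0 : 0 < Skeleton.ell D := zero_lt_one.trans hℓ1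
  have hκ0 : 0 ≤ Skeleton.ell D ^ κ := Real.rpow_nonneg hℓ0.le κ
  by_cases hC : C ≤ 0
  · exact (mul_nonpos_of_nonpos_of_nonneg hC hκ0).trans (by positivity)
  have hC0 : 0 < C := not_le.mp hC
  -- `𝓛^{6−κ} ≥ T ≥ C/ε`
  have hroom : T ≤ Skeleton.ell D ^ (6 - κ) := by
    have h1 : (T ^ (1 / (6 - κ))) ^ (6 - κ) ≤ Skeleton.ell D ^ (6 - κ) :=
      Real.rpow_le_rpow (Real.rpow_nonneg hT0 _) hL hgap.le
    rwa [one_div, Real.rpow_inv_rpow hT0 hgap.ne'] at h1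
  have hCε : C / ε ≤ Skeleton.ell D ^ (6 - κ) := (le_max_left _ _).trans hroom
  have h6 : Skeleton.ell D ^ (6 : ℝ) = Skeleton.ell D ^ κ * Skeleton.ell D ^ (6 - κ) := by
    rw [← Real.rpow_add hℓ0]; ring_nf
  have h6' : (Skeleton.ell D ^ 6 : ℝ) = Skeleton.ell D ^ (6 : ℝ) := by
    rw [show (6 : ℝ) = ((6 : ℕ) : ℝ) by norm_num, Real.rpow_natCast]
  rw [h6', h6]
  rw [div_le_iff₀ hε] at hCε
  calc C * Skeleton.ell D ^ κ = Skeleton.ell D ^ κ * C := mul_comm _ _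
    _ ≤ Skeleton.ell D ^ κ * (Skeleton.ell D ^ (6 - κ) * ε) := mul_le_mul_of_nonneg_left hCε hκ0
    _ = ε * (Skeleton.ell D ^ κ * Skeleton.ell D ^ (6 - κ)) := by ring

/-- **THE REDUCTION THEOREM.** For every `κ < 6`, every band exponent `m`, every Lipschitz constant `K` and every
`η > 0`: the large-sieve-type slot E-004′(κ) `BandMeanValue c′ m κ`, together with the manuscript's displayed nodes
Prop 7.1, Lemma 8.1, Prop 2.2 (i), Lemma 2.3 (through the units lemma `discWeight ≤ 3𝓛⁹𝔓`, p467613, and `𝔞 ≥ a₀`,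
`frakALowerBound_holds`), gives E-004 on the true band in its (A)-form for the whole class `WallZeroLip K`:
`DiscMeanTrueBandAOn (WallZeroLip K) c′ m η`. Arithmetic: block mean `≤ 𝓛^κ·3𝓛⁹𝔓·K²(m+3)³𝓛^{−15} = O(𝓛^{κ−6})·𝔞𝔓`.
[cite: Zhang2022LandauSiegel, §2 (2.16)–(2.20), (2.30)–(2.31), Lemma 2.3; §5 Lemma 5.7; §7 Prop 7.1; §8 Lemma 8.1] -/
theorem discMeanTrueBandAOn_wallZeroLip_of_bandMeanValue (c' : ℝ) (m : ℕ) (K : ℝ≥0) {κ η : ℝ} (hκ : κ < 6)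
    (hη : 0 < η) (hB : BandMeanValue c' m κ) (h71 : Prop71 c') (h81 : Lemma81 c') (h22 : Prop22i)
    (h23 : Lemma23 c') :
    DiscMeanTrueBandAOn (WallZeroLip K) c' m η := by
  obtain ⟨a₀, ha₀, hA⟩ := frakALowerBound_holds
  have hW := Skeleton.discWeight_trivialScale_window c' h71 h81 h22 h23
  -- the loss constant `C = (2/η + 1)·3·K²(m+3)³` against the room `ε = (η/2)·a₀`
  set C : ℝ := (2 / η + 1) * (3 * ((K : ℝ) ^ 2 * ((m : ℝ) + 3) ^ 3)) with hCdef
  have hroom := loss_le_room_eventually hκ C (ε := η / 2 * a₀) (by positivity)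
  refine ((((hB.and hW).and hA).and ((coefBlockMass_profCoef_le m).and hroom)).and
    (forAllLarge_three_le_and_le_ell 1)).mono ?_
  intro D _ χ _ _ h hAss hb g hg N hN₁ hN₂
  obtain ⟨⟨⟨⟨hBD, hWD⟩, hAD⟩, hMD, hRD⟩, hD3, -⟩ := h
  have hℓ1 : 1 < Skeleton.ell D := Skeleton.one_lt_ell hD3
  have hℓ0 : 0 < Skeleton.ell D := zero_lt_one.trans hℓ1
  have hP0 : 0 < Skeleton.bigP D := Real.exp_pos _
  have hfP : 0 ≤ frakP D := frakP_nonneg D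
  have hM₀1 : 1 ≤ ⌈Skeleton.bigP D⌉₊ := Nat.one_le_ceil_iff.mpr hP0
  set a : ℕ → ℂ := profCoef D g with ha
  -- the four inputs at this `D`
  have h1 : coefBlockMean c' χ a ⌈Skeleton.bigP D⌉₊ N ≤
      Skeleton.ell D ^ κ * discWeight c' χ * coefBlockMass a ⌈Skeleton.bigP D⌉₊ N := hBD hb a N hN₁ hN₂
  have h2 : coefBlockMass a ⌈Skeleton.bigP D⌉₊ N ≤ (K : ℝ) ^ 2 * ((m : ℝ) + 3) ^ 3 * (Skeleton.ell D ^ 15)⁻¹ :=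
    hMD K g hg N hN₁ hN₂
  have h3 : discWeight c' χ ≤ 3 * Skeleton.ell D ^ 9 * frakP D := (hWD hAss).2
  have h4 : a₀ ≤ Skeleton.frakA χ := hAD hAss
  have h5 : C * Skeleton.ell D ^ κ ≤ η / 2 * a₀ * Skeleton.ell D ^ 6 := hRD
  have hκ0 : 0 ≤ Skeleton.ell D ^ κ := Real.rpow_nonneg hℓ0.le κ
  -- block mean ≤ (η/2)·a₀·𝔓/(2/η+1)
  have hbm : (2 / η + 1) * coefBlockMean c' χ a ⌈Skeleton.bigP D⌉₊ N ≤ η / 2 * (a₀ * frakP D) := by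
    have hstep : coefBlockMean c' χ a ⌈Skeleton.bigP D⌉₊ N ≤
        Skeleton.ell D ^ κ * (3 * Skeleton.ell D ^ 9 * frakP D) *
          ((K : ℝ) ^ 2 * ((m : ℝ) + 3) ^ 3 * (Skeleton.ell D ^ 15)⁻¹) := by
      refine h1.trans ?_
      refine mul_le_mul ?_ h2 (coefBlockMass_nonneg _ _ _) ?_
      · exact mul_le_mul_of_nonneg_left h3 hκ0
      · exact mul_nonneg hκ0 (by positivity)
    have hid : (2 / η + 1) * (Skeleton.ell D ^ κ * (3 * Skeleton.ell D ^ 9 * frakP D) *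
        ((K : ℝ) ^ 2 * ((m : ℝ) + 3) ^ 3 * (Skeleton.ell D ^ 15)⁻¹)) =
        (C * Skeleton.ell D ^ κ) * (frakP D * (Skeleton.ell D ^ 9 * (Skeleton.ell D ^ 15)⁻¹)) := by
      rw [hCdef]; ring
    have hid2 : η / 2 * a₀ * Skeleton.ell D ^ 6 * (frakP D * (Skeleton.ell D ^ 9 * (Skeleton.ell D ^ 15)⁻¹)) =
        η / 2 * (a₀ * frakP D) := by
      field_simp
    calc (2 / η + 1) * coefBlockMean c' χ a ⌈Skeleton.bigP D⌉₊ N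
        ≤ (2 / η + 1) * (Skeleton.ell D ^ κ * (3 * Skeleton.ell D ^ 9 * frakP D) *
            ((K : ℝ) ^ 2 * ((m : ℝ) + 3) ^ 3 * (Skeleton.ell D ^ 15)⁻¹)) :=
          mul_le_mul_of_nonneg_left hstep (by positivity)
      _ = (C * Skeleton.ell D ^ κ) * (frakP D * (Skeleton.ell D ^ 9 * (Skeleton.ell D ^ 15)⁻¹)) := hid
      _ ≤ (η / 2 * a₀ * Skeleton.ell D ^ 6) * (frakP D * (Skeleton.ell D ^ 9 * (Skeleton.ell D ^ 15)⁻¹)) :=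
          mul_le_mul_of_nonneg_right h5 (by positivity)
      _ = η / 2 * (a₀ * frakP D) := hid2
  -- Cauchy–Schwarz in ε-form with `η/2`
  have hcs := abs_discMean_sub_le_coefBlockMean c' χ g hM₀1 hN₁ (η := η / 2) (by positivity)
  have hcoef : 1 / (η / 2) + 1 = 2 / η + 1 := by field_simp
  rw [hcoef] at hcs
  have haP : a₀ * frakP D ≤ Skeleton.frakA χ * frakP D := mul_le_mul_of_nonneg_right h4 hfP
  have hAbs0 : 0 ≤ discMeanAbs c' χ g ⌈Skeleton.bigP D⌉₊ := discMeanAbs_nonneg c' χ g _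
  have hfA0 : 0 ≤ Skeleton.frakA χ * frakP D := le_trans (by positivity) haP
  calc |discMean c' χ g N - discMean c' χ g ⌈Skeleton.bigP D⌉₊|
      ≤ η / 2 * discMeanAbs c' χ g ⌈Skeleton.bigP D⌉₊ +
          (2 / η + 1) * coefBlockMean c' χ (profCoef D g) ⌈Skeleton.bigP D⌉₊ N := hcs
    _ ≤ η / 2 * discMeanAbs c' χ g ⌈Skeleton.bigP D⌉₊ + η / 2 * (Skeleton.frakA χ * frakP D) := by
        have := hbm.trans (mul_le_mul_of_nonneg_left haP (by positivity))
        linarith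
    _ ≤ η * (discMeanAbs c' χ g ⌈Skeleton.bigP D⌉₊ + Skeleton.frakA χ * frakP D) := by
        nlinarith

/-- **Corollary (slot of record, (A)-form):** `κ < 6`, E-004′(κ) and the four nodes give `DiscMeanTrueBandA c′ m η` for
every `η > 0` (class: globally 1-Lipschitz, `‖g‖ ≤ 1`, `g(1) = 0`, p470415).
[cite: Zhang2022LandauSiegel, §2 (2.16)–(2.20), (2.30)–(2.31); §7 Prop 7.1; §8 Lemma 8.1] -/
theorem discMeanTrueBandA_of_bandMeanValue (c' : ℝ) (m : ℕ) {κ η : ℝ} (hκ : κ < 6) (hη : 0 < η)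
    (hB : BandMeanValue c' m κ) (h71 : Prop71 c') (h81 : Lemma81 c') (h22 : Prop22i) (h23 : Lemma23 c') :
    DiscMeanTrueBandA c' m η :=
  (discMeanTrueBandAOn_wallZeroLip_of_bandMeanValue c' m 1 hκ hη hB h71 h81 h22 h23).anti wallZeroLip_of_wallZero

/-- **Corollary (glued slot, (A)-form):** `κ < 6`, E-004′(κ) and the four nodes give `DiscMeanTrueBandAKM c′ K M m η` for
every `η > 0` (class `GluedWallZeroClass K M`, p471890). [cite: Zhang2022LandauSiegel, §2 (2.16)–(2.20), (2.30)–(2.31); §7 Prop 7.1; §8 Lemma 8.1] -/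
theorem discMeanTrueBandAKM_of_bandMeanValue (c' : ℝ) (K : ℝ≥0) (M : ℝ) (m : ℕ) {κ η : ℝ} (hκ : κ < 6)
    (hη : 0 < η) (hB : BandMeanValue c' m κ) (h71 : Prop71 c') (h81 : Lemma81 c') (h22 : Prop22i)
    (h23 : Lemma23 c') :
    DiscMeanTrueBandAKM c' K M m η :=
  (discMeanTrueBandAOn_wallZeroLip_of_bandMeanValue c' m K hκ hη hB h71 h81 h22 h23).anti
    fun g hg => wallZeroLip_of_glued g hg

/-! ### Part 6 (v2) — the CLASS-RESTRICTED slot of record E-004″ `BandMeanValueLip` and the reduction from it -/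

/-- **E-004′ restricted to a coefficient class `𝒞`** (hypothesis shape, kind (c); NOT asserted): the inequality of
`BandMeanValue` asked only for the coefficient sequences `a` with `𝒞 D a` (the class may depend on the modulus `D`, as
the profile coefficients `profCoef D g` do). [cite: Zhang2022LandauSiegel, §2 (2.14)–(2.16), (2.30); §7 Prop 7.1, (7.2)] -/
def BandMeanValueOn (𝒞 : ℕ → (ℕ → ℂ) → Prop) (c' : ℝ) (m : ℕ) (κ : ℝ) : Prop :=
  Skeleton.ForAllLarge fun D _ χ =>
    (∀ i ∈ Skeleton.idx χ, (i.2).re = 1 / 2) →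
      ∀ a : ℕ → ℂ, 𝒞 D a → ∀ N : ℕ, ⌈Skeleton.bigP D⌉₊ ≤ N → N ≤ bandEdge D m →
        coefBlockMean c' χ a ⌈Skeleton.bigP D⌉₊ N ≤
          Skeleton.ell D ^ κ * discWeight c' χ * coefBlockMass a ⌈Skeleton.bigP D⌉₊ N

/-- The all-coefficients slot implies every class-restricted one. [cite: Zhang2022LandauSiegel, §2 (2.14)–(2.16)] -/
theorem BandMeanValue.on {c' : ℝ} {m : ℕ} {κ : ℝ} (h : BandMeanValue c' m κ) (𝒞 : ℕ → (ℕ → ℂ) → Prop) :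
    BandMeanValueOn 𝒞 c' m κ :=
  Skeleton.ForAllLarge.mono h fun _ _ _ _ _ hB hb a _ N hN₁ hN₂ => hB hb a N hN₁ hN₂

/-- The class-restricted slot is antitone in the class. [cite: Zhang2022LandauSiegel, §2 (2.14)–(2.16)] -/
theorem BandMeanValueOn.anti {𝒞 𝒞' : ℕ → (ℕ → ℂ) → Prop} {c' : ℝ} {m : ℕ} {κ : ℝ}
    (h𝒞 : ∀ D a, 𝒞 D a → 𝒞' D a) (h : BandMeanValueOn 𝒞' c' m κ) : BandMeanValueOn 𝒞 c' m κ :=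
  Skeleton.ForAllLarge.mono h fun D _ _ _ _ hB hb a ha N hN₁ hN₂ => hB hb a (h𝒞 D a ha) N hN₁ hN₂

/-- The class-restricted slot is antitone in the band exponent `m` and monotone in the loss `κ`.
[cite: Zhang2022LandauSiegel, §2 (2.30)] -/
theorem BandMeanValueOn.mono {𝒞 : ℕ → (ℕ → ℂ) → Prop} {c' : ℝ} {m m' : ℕ} {κ κ' : ℝ} (hm : m' ≤ m)
    (hκ : κ ≤ κ') (h : BandMeanValueOn 𝒞 c' m κ) : BandMeanValueOn 𝒞 c' m' κ' := by
  refine (h.and (Skeleton.ForAllLarge.of_le 3 fun D _ _ hD _ _ => hD)).mono ?_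
  intro D _ χ _ _ hh hb a ha N hN₁ hN₂
  obtain ⟨hB, hD3⟩ := hh
  have hℓ1 : 1 ≤ Skeleton.ell D := (Skeleton.one_lt_ell hD3).le
  have h1 := hB hb a ha N hN₁ (hN₂.trans (bandEdge_mono hD3 hm))
  refine h1.trans (mul_le_mul_of_nonneg_right (mul_le_mul_of_nonneg_right
    (Real.rpow_le_rpow_of_exponent_le hℓ1 hκ) (discWeight_nonneg_aux c' χ)) (coefBlockMass_nonneg _ _ _))

/-- **The coefficient class of the wall-zero Lipschitz profiles**: at modulus `D`, the sequences `a = profCoef D g`,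
`a(n) = g(log n/log P)`, with `g` `K`-Lipschitz on `[1, ∞)` and `g(1) = 0`. [cite: Zhang2022LandauSiegel, §7 (7.2) p.44] -/
def profCoefClass (K : ℝ≥0) (D : ℕ) (a : ℕ → ℂ) : Prop := ∃ g : ℝ → ℂ, WallZeroLip K g ∧ a = profCoef D g

/-- **E-004″(K, κ) — THE SLOT OF RECORD FOR ROWS** (hypothesis shape, kind (c); NOT asserted; the logically weakest premise
that gives the reduction): the family mean square of the band block of a wall-zero `K`-Lipschitz profile is at most `𝓛^κ`
times its diagonal — `BandMeanValueOn (profCoefClass K)`: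
for all large `D`, under (b), for every `g ∈ WallZeroLip K` and every `⌈P⌉ ≤ N ≤ ⌈D·P·𝓛^m⌉ + 1`,
`Σ_{(ψ,ρ)} |Re𝔠*·Reω|·|Σ_{⌈P⌉≤n<N} χψ(n) g(log n/log P) n^{−ρ}|² ≤ 𝓛^κ·discWeight·Σ_{⌈P⌉≤n<N}|g(log n/log P)|²/n`. This is
E-004 in MEAN-SQUARE form with the room made explicit; its derivation is the manuscript's formula I across the wall
(derivation-OPEN). [cite: Zhang2022LandauSiegel, §2 (2.14)–(2.16), (2.30); §7 Prop 7.1, (7.2); §8 Lemma 8.1] -/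
def BandMeanValueLip (c' : ℝ) (K : ℝ≥0) (m : ℕ) (κ : ℝ) : Prop := BandMeanValueOn (profCoefClass K) c' m κ

/-- E-004′ (all coefficients) implies E-004″ (class-restricted). [cite: Zhang2022LandauSiegel, §2 (2.14)–(2.16)] -/
theorem BandMeanValue.lip {c' : ℝ} {m : ℕ} {κ : ℝ} (h : BandMeanValue c' m κ) (K : ℝ≥0) :
    BandMeanValueLip c' K m κ :=
  h.on _

/-- E-004″ is antitone in `K` (a larger Lipschitz constant is a larger class) and in `m`, monotone in `κ`.
[cite: Zhang2022LandauSiegel, §2 (2.30); §7 (7.2) p.44] -/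
theorem BandMeanValueLip.mono {c' : ℝ} {K K' : ℝ≥0} {m m' : ℕ} {κ κ' : ℝ} (hK : K' ≤ K) (hm : m' ≤ m)
    (hκ : κ ≤ κ') (h : BandMeanValueLip c' K m κ) : BandMeanValueLip c' K' m' κ' := by
  refine BandMeanValueOn.mono hm hκ (BandMeanValueOn.anti ?_ h)
  rintro D a ⟨g, hg, rfl⟩
  exact ⟨g, ⟨hg.1.weaken hK, hg.2⟩, rfl⟩

/-- **THE REDUCTION THEOREM from a class-restricted slot.** For every coefficient class `𝒞` containing the profile
coefficients of `WallZeroLip K` (at every modulus), every `κ < 6`, `m`, `η > 0`: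
`BandMeanValueOn 𝒞 c′ m κ → Prop71 c′ → Lemma81 c′ → Prop22i → Lemma23 c′ → DiscMeanTrueBandAOn (WallZeroLip K) c′ m η`.
Same arithmetic as `discMeanTrueBandAOn_wallZeroLip_of_bandMeanValue` (which is the case `𝒞 = ⊤`).
[cite: Zhang2022LandauSiegel, §2 (2.16)–(2.20), (2.30)–(2.31), Lemma 2.3; §5 Lemma 5.7; §7 Prop 7.1; §8 Lemma 8.1] -/
theorem discMeanTrueBandAOn_wallZeroLip_of_bandMeanValueOn {𝒞 : ℕ → (ℕ → ℂ) → Prop} (c' : ℝ) (m : ℕ) (K : ℝ≥0)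
    {κ η : ℝ} (hκ : κ < 6) (hη : 0 < η) (h𝒞 : ∀ (D : ℕ) (g : ℝ → ℂ), WallZeroLip K g → 𝒞 D (profCoef D g))
    (hB : BandMeanValueOn 𝒞 c' m κ) (h71 : Prop71 c') (h81 : Lemma81 c') (h22 : Prop22i) (h23 : Lemma23 c') :
    DiscMeanTrueBandAOn (WallZeroLip K) c' m η := by
  obtain ⟨a₀, ha₀, hA⟩ := frakALowerBound_holds
  have hW := Skeleton.discWeight_trivialScale_window c' h71 h81 h22 h23
  set C : ℝ := (2 / η + 1) * (3 * ((K : ℝ) ^ 2 * ((m : ℝ) + 3) ^ 3)) with hCdef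
  have hroom := loss_le_room_eventually hκ C (ε := η / 2 * a₀) (by positivity)
  refine ((((hB.and hW).and hA).and ((coefBlockMass_profCoef_le m).and hroom)).and
    (forAllLarge_three_le_and_le_ell 1)).mono ?_
  intro D _ χ _ _ h hAss hb g hg N hN₁ hN₂
  obtain ⟨⟨⟨⟨hBD, hWD⟩, hAD⟩, hMD, hRD⟩, hD3, -⟩ := h
  have hℓ1 : 1 < Skeleton.ell D := Skeleton.one_lt_ell hD3
  have hℓ0 : 0 < Skeleton.ell D := zero_lt_one.trans hℓ1
  have hP0 : 0 < Skeleton.bigP D := Real.exp_pos _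
  have hfP : 0 ≤ frakP D := frakP_nonneg D
  have hM₀1 : 1 ≤ ⌈Skeleton.bigP D⌉₊ := Nat.one_le_ceil_iff.mpr hP0
  set a : ℕ → ℂ := profCoef D g with ha
  have h1 : coefBlockMean c' χ a ⌈Skeleton.bigP D⌉₊ N ≤
      Skeleton.ell D ^ κ * discWeight c' χ * coefBlockMass a ⌈Skeleton.bigP D⌉₊ N :=
    hBD hb a (h𝒞 D g hg) N hN₁ hN₂
  have h2 : coefBlockMass a ⌈Skeleton.bigP D⌉₊ N ≤ (K : ℝ) ^ 2 * ((m : ℝ) + 3) ^ 3 * (Skeleton.ell D ^ 15)⁻¹ :=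
    hMD K g hg N hN₁ hN₂
  have h3 : discWeight c' χ ≤ 3 * Skeleton.ell D ^ 9 * frakP D := (hWD hAss).2
  have h4 : a₀ ≤ Skeleton.frakA χ := hAD hAss
  have h5 : C * Skeleton.ell D ^ κ ≤ η / 2 * a₀ * Skeleton.ell D ^ 6 := hRD
  have hκ0 : 0 ≤ Skeleton.ell D ^ κ := Real.rpow_nonneg hℓ0.le κ
  have hbm : (2 / η + 1) * coefBlockMean c' χ a ⌈Skeleton.bigP D⌉₊ N ≤ η / 2 * (a₀ * frakP D) := by
    have hstep : coefBlockMean c' χ a ⌈Skeleton.bigP D⌉₊ N ≤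
        Skeleton.ell D ^ κ * (3 * Skeleton.ell D ^ 9 * frakP D) *
          ((K : ℝ) ^ 2 * ((m : ℝ) + 3) ^ 3 * (Skeleton.ell D ^ 15)⁻¹) := by
      refine h1.trans ?_
      refine mul_le_mul ?_ h2 (coefBlockMass_nonneg _ _ _) ?_
      · exact mul_le_mul_of_nonneg_left h3 hκ0
      · exact mul_nonneg hκ0 (by positivity)
    have hid : (2 / η + 1) * (Skeleton.ell D ^ κ * (3 * Skeleton.ell D ^ 9 * frakP D) *
        ((K : ℝ) ^ 2 * ((m : ℝ) + 3) ^ 3 * (Skeleton.ell D ^ 15)⁻¹)) =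
        (C * Skeleton.ell D ^ κ) * (frakP D * (Skeleton.ell D ^ 9 * (Skeleton.ell D ^ 15)⁻¹)) := by
      rw [hCdef]; ring
    have hid2 : η / 2 * a₀ * Skeleton.ell D ^ 6 * (frakP D * (Skeleton.ell D ^ 9 * (Skeleton.ell D ^ 15)⁻¹)) =
        η / 2 * (a₀ * frakP D) := by
      field_simp
    calc (2 / η + 1) * coefBlockMean c' χ a ⌈Skeleton.bigP D⌉₊ N
        ≤ (2 / η + 1) * (Skeleton.ell D ^ κ * (3 * Skeleton.ell D ^ 9 * frakP D) *
            ((K : ℝ) ^ 2 * ((m : ℝ) + 3) ^ 3 * (Skeleton.ell D ^ 15)⁻¹)) :=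
          mul_le_mul_of_nonneg_left hstep (by positivity)
      _ = (C * Skeleton.ell D ^ κ) * (frakP D * (Skeleton.ell D ^ 9 * (Skeleton.ell D ^ 15)⁻¹)) := hid
      _ ≤ (η / 2 * a₀ * Skeleton.ell D ^ 6) * (frakP D * (Skeleton.ell D ^ 9 * (Skeleton.ell D ^ 15)⁻¹)) :=
          mul_le_mul_of_nonneg_right h5 (by positivity)
      _ = η / 2 * (a₀ * frakP D) := hid2
  have hcs := abs_discMean_sub_le_coefBlockMean c' χ g hM₀1 hN₁ (η := η / 2) (by positivity)
  have hcoef : 1 / (η / 2) + 1 = 2 / η + 1 := by field_simp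
  rw [hcoef] at hcs
  have haP : a₀ * frakP D ≤ Skeleton.frakA χ * frakP D := mul_le_mul_of_nonneg_right h4 hfP
  have hAbs0 : 0 ≤ discMeanAbs c' χ g ⌈Skeleton.bigP D⌉₊ := discMeanAbs_nonneg c' χ g _
  have hfA0 : 0 ≤ Skeleton.frakA χ * frakP D := le_trans (by positivity) haP
  calc |discMean c' χ g N - discMean c' χ g ⌈Skeleton.bigP D⌉₊|
      ≤ η / 2 * discMeanAbs c' χ g ⌈Skeleton.bigP D⌉₊ +
          (2 / η + 1) * coefBlockMean c' χ (profCoef D g) ⌈Skeleton.bigP D⌉₊ N := hcs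
    _ ≤ η / 2 * discMeanAbs c' χ g ⌈Skeleton.bigP D⌉₊ + η / 2 * (Skeleton.frakA χ * frakP D) := by
        have := hbm.trans (mul_le_mul_of_nonneg_left haP (by positivity))
        linarith
    _ ≤ η * (discMeanAbs c' χ g ⌈Skeleton.bigP D⌉₊ + Skeleton.frakA χ * frakP D) := by
        nlinarith

/-- **Reduction from the slot of record E-004″:** for every `κ < 6`, `m`, `K`, `η > 0`,
`BandMeanValueLip c′ K m κ → Prop71 c′ → Lemma81 c′ → Prop22i → Lemma23 c′ → DiscMeanTrueBandAOn (WallZeroLip K) c′ m η`.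
[cite: Zhang2022LandauSiegel, §2 (2.16)–(2.20), (2.30)–(2.31); §7 Prop 7.1; §8 Lemma 8.1] -/
theorem discMeanTrueBandAOn_wallZeroLip_of_bandMeanValueLip (c' : ℝ) (m : ℕ) (K : ℝ≥0) {κ η : ℝ} (hκ : κ < 6)
    (hη : 0 < η) (hB : BandMeanValueLip c' K m κ) (h71 : Prop71 c') (h81 : Lemma81 c') (h22 : Prop22i)
    (h23 : Lemma23 c') :
    DiscMeanTrueBandAOn (WallZeroLip K) c' m η :=
  discMeanTrueBandAOn_wallZeroLip_of_bandMeanValueOn c' m K hκ hη (fun _ g hg => ⟨g, hg, rfl⟩) hB h71 h81 h22 h23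

/-- **Corollary (slot of record of p470415, (A)-form) from E-004″ with `K = 1`.**
[cite: Zhang2022LandauSiegel, §2 (2.16)–(2.20), (2.30)–(2.31); §7 Prop 7.1; §8 Lemma 8.1] -/
theorem discMeanTrueBandA_of_bandMeanValueLip (c' : ℝ) (m : ℕ) {κ η : ℝ} (hκ : κ < 6) (hη : 0 < η)
    (hB : BandMeanValueLip c' 1 m κ) (h71 : Prop71 c') (h81 : Lemma81 c') (h22 : Prop22i) (h23 : Lemma23 c') :
    DiscMeanTrueBandA c' m η :=
  (discMeanTrueBandAOn_wallZeroLip_of_bandMeanValueLip c' m 1 hκ hη hB h71 h81 h22 h23).anti wallZeroLip_of_wallZero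

/-- **Corollary (glued slot of p471890, (A)-form) from E-004″ with the design's own `K`.**
[cite: Zhang2022LandauSiegel, §2 (2.16)–(2.20), (2.30)–(2.31); §7 Prop 7.1; §8 Lemma 8.1] -/
theorem discMeanTrueBandAKM_of_bandMeanValueLip (c' : ℝ) (K : ℝ≥0) (M : ℝ) (m : ℕ) {κ η : ℝ} (hκ : κ < 6)
    (hη : 0 < η) (hB : BandMeanValueLip c' K m κ) (h71 : Prop71 c') (h81 : Lemma81 c') (h22 : Prop22i)
    (h23 : Lemma23 c') :
    DiscMeanTrueBandAKM c' K M m η :=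
  (discMeanTrueBandAOn_wallZeroLip_of_bandMeanValueLip c' m K hκ hη hB h71 h81 h22 h23).anti
    fun g hg => wallZeroLip_of_glued g hg

/-! ### Part 7 (v4) — TIGHTNESS OF THE ROOM: at `κ = 6` the diagonal-scale bound is of size `𝔓`, not `o(𝔞𝔓)` -/

/-- Harmonic lower bound: `log b − log a ≤ Σ_{a ≤ n < b} 1/n` for `1 ≤ a ≤ b` (`log(1 + 1/n) ≤ 1/n`). [folklore] -/
private theorem log_sub_log_le_sum_Ico_inv {a : ℕ} (ha : 1 ≤ a) {b : ℕ} (hab : a ≤ b) :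
    Real.log b - Real.log a ≤ ∑ n ∈ Finset.Ico a b, (n : ℝ)⁻¹ := by
  induction b, hab using Nat.le_induction with
  | base => simp
  | succ b hb ih =>
    rw [Finset.sum_Ico_succ_top hb, Nat.cast_succ]
    have hb0 : (0 : ℝ) < b := by exact_mod_cast lt_of_lt_of_le ha hb
    have h1 : Real.log ((b : ℝ) + 1) - Real.log b ≤ (b : ℝ)⁻¹ := by
      rw [← Real.log_div (by linarith) hb0.ne']
      have := Real.log_le_sub_one_of_pos (show (0:ℝ) < ((b : ℝ) + 1) / b by positivity)
      have e : ((b : ℝ) + 1) / b - 1 = (b : ℝ)⁻¹ := by field_simp; ring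
      linarith
    linarith

/-- **The wall tent** `g(z) = max(0, min(z − 1, 3 − z))` (the triangular overhang of top `3`, member of both
wall-zero rows: `inClass_triangle`). [cite: Zhang2022LandauSiegel, §7 (7.2) p.44] -/
def wallTent (z : ℝ) : ℂ := ((max 0 (min (z - 1) (3 - z)) : ℝ) : ℂ)

/-- The wall tent is in `WallZeroLip 1` (indeed in the wall-value-zero class of record).
[cite: Zhang2022LandauSiegel, §7 (7.2) p.44] -/
theorem wallTent_wallZeroLip : WallZeroLip 1 wallTent :=
  wallZeroLip_of_wallZero wallTent (inClass_triangle 0 (by norm_num : (1:ℝ) ≤ 3) le_rfl)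

/-- On `[1, 2]` the wall tent is `z − 1`. [cite: Zhang2022LandauSiegel, §7 (7.2) p.44] -/
theorem wallTent_eq_of_mem {z : ℝ} (h1 : 1 ≤ z) (h2 : z ≤ 2) : wallTent z = ((z - 1 : ℝ) : ℂ) := by
  unfold wallTent
  rw [min_eq_left (by linarith), max_eq_right (by linarith)]

/-- **BAND MASS LOWER BOUND for the wall tent:** for every `m` there is `D₀` with, for `D ≥ D₀`,
`Σ_{⌈P⌉ ≤ n < bandEdge D m} |g(log n/log P)|²/n ≥ 𝓛^{−15}/16` (`z_n − 1 ≥ 𝓛⁻⁸/2` on `n ≥ P√D`, and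
`Σ_{P√D < n < D·P·𝓛^m} 1/n ≥ 𝓛/4`). So the geometry bound `coefBlockMass_profCoef_le` (`≤ K²(m+3)³𝓛^{−15}`) has the
right order in `𝓛`. [cite: Zhang2022LandauSiegel, §2 (2.30); §7 (7.2) p.44] -/
theorem coefBlockMass_wallTent_ge (m : ℕ) :
    Skeleton.ForAllLarge fun D _ _ =>
      (Skeleton.ell D ^ 15)⁻¹ / 16 ≤ coefBlockMass (profCoef D wallTent) ⌈Skeleton.bigP D⌉₊ (bandEdge D m) := by
  refine (forAllLarge_three_le_and_le_ell (max 8 ((m : ℝ) + 2))).mono ?_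
  intro D _ _ _ _ h
  obtain ⟨hD3, hLmax⟩ := h
  have hL8 : 8 ≤ Skeleton.ell D := le_trans (le_max_left _ _) hLmax
  have hLm : (m : ℝ) + 2 ≤ Skeleton.ell D := le_trans (le_max_right _ _) hLmax
  have hℓ1 : 1 < Skeleton.ell D := Skeleton.one_lt_ell hD3
  have hℓ0 : 0 < Skeleton.ell D := zero_lt_one.trans hℓ1
  have hP0 : 0 < Skeleton.bigP D := Real.exp_pos _
  have hP1 : 1 ≤ Skeleton.bigP D := by rw [Skeleton.bigP]; exact Real.one_le_exp (by positivity)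
  have hlogP : Real.log (Skeleton.bigP D) = Skeleton.ell D ^ 9 := by rw [Skeleton.bigP, Real.log_exp]
  have hD0 : (0 : ℝ) < D := by exact_mod_cast lt_of_lt_of_le (by norm_num) hD3
  have hD1 : (1 : ℝ) ≤ D := by exact_mod_cast le_trans (by norm_num) hD3
  have hlogD : Real.log D = Skeleton.ell D := rfl
  -- the lower cut `A = ⌈P·√D⌉`
  set A : ℕ := ⌈Skeleton.bigP D * Real.sqrt D⌉₊ with hA
  have hsqD1 : 1 ≤ Real.sqrt D := Real.one_le_sqrt.mpr hD1
  have hsqD0 : 0 < Real.sqrt D := by positivity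
  have hPA : ⌈Skeleton.bigP D⌉₊ ≤ A := Nat.ceil_mono (le_mul_of_one_le_right hP0.le hsqD1)
  have hA1 : 1 ≤ A := Nat.one_le_ceil_iff.mpr (by positivity)
  have hAr : Skeleton.bigP D * Real.sqrt D ≤ A := Nat.le_ceil _
  have hAr' : (A : ℝ) ≤ 2 * (Skeleton.bigP D * Real.sqrt D) := by
    have := Nat.ceil_lt_add_one (show 0 ≤ Skeleton.bigP D * Real.sqrt D by positivity)
    have h1 : 1 ≤ Skeleton.bigP D * Real.sqrt D := one_le_mul_of_one_le_of_one_le hP1 hsqD1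
    rw [hA]; linarith
  -- `A ≤ bandEdge`
  have hbeR : (D : ℝ) * Skeleton.bigP D * Skeleton.ell D ^ m ≤ (bandEdge D m : ℕ) := by
    unfold bandEdge; push_cast
    exact (Nat.le_ceil _).trans (by linarith)
  have hsqD_le : Real.sqrt D ≤ D := by
    calc Real.sqrt D ≤ Real.sqrt D * Real.sqrt D := le_mul_of_one_le_right hsqD0.le hsqD1
      _ = D := Real.mul_self_sqrt hD0.le
  have hAbe : A ≤ bandEdge D m := by
    have h1 : Skeleton.bigP D * Real.sqrt D ≤ (D : ℝ) * Skeleton.bigP D * Skeleton.ell D ^ m := by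
      calc Skeleton.bigP D * Real.sqrt D ≤ Skeleton.bigP D * D := mul_le_mul_of_nonneg_left hsqD_le hP0.le
        _ = (D : ℝ) * Skeleton.bigP D * 1 := by ring
        _ ≤ (D : ℝ) * Skeleton.bigP D * Skeleton.ell D ^ m :=
            mul_le_mul_of_nonneg_left (one_le_pow₀ hℓ1.le) (by positivity)
    have : (A : ℝ) ≤ ((bandEdge D m : ℕ) : ℝ) + 1 := by
      have := Nat.ceil_lt_add_one (show 0 ≤ Skeleton.bigP D * Real.sqrt D by positivity)
      rw [hA]; linarith [h1.trans hbeR]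
    unfold bandEdge at this ⊢
    have h2 : A ≤ ⌈(D : ℝ) * Skeleton.bigP D * Skeleton.ell D ^ m⌉₊ + 1 := by
      have h3 : Skeleton.bigP D * Real.sqrt D ≤ (D : ℝ) * Skeleton.bigP D * Skeleton.ell D ^ m := h1
      exact (Nat.ceil_mono h3).trans (Nat.le_succ _)
    exact h2
  -- restrict the mass to `[A, bandEdge)`
  have hsub : Finset.Ico A (bandEdge D m) ⊆ Finset.Ico ⌈Skeleton.bigP D⌉₊ (bandEdge D m) :=
    Finset.Ico_subset_Ico hPA le_rfl
  have hmass : ∑ n ∈ Finset.Ico A (bandEdge D m), ‖profCoef D wallTent n‖ ^ 2 / n ≤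
      coefBlockMass (profCoef D wallTent) ⌈Skeleton.bigP D⌉₊ (bandEdge D m) := by
    unfold coefBlockMass
    exact Finset.sum_le_sum_of_subset_of_nonneg hsub fun _ _ _ => div_nonneg (sq_nonneg _) (Nat.cast_nonneg _)
  refine le_trans ?_ hmass
  -- pointwise: `‖g(z_n)‖² ≥ (𝓛⁻⁸/2)²` on `[A, bandEdge)`
  have hpt : ∀ n ∈ Finset.Ico A (bandEdge D m),
      ((Skeleton.ell D ^ 8)⁻¹ / 2) ^ 2 * (n : ℝ)⁻¹ ≤ ‖profCoef D wallTent n‖ ^ 2 / n := by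
    intro n hn
    have hn1 : A ≤ n := (Finset.mem_Ico.mp hn).1
    have hn2 : n < bandEdge D m := (Finset.mem_Ico.mp hn).2
    have hnr : Skeleton.bigP D * Real.sqrt D ≤ n := hAr.trans (by exact_mod_cast hn1)
    have hn0 : (0 : ℝ) < n := lt_of_lt_of_le (by positivity) hnr
    set z : ℝ := Real.log n / Real.log (Skeleton.bigP D) with hz
    -- `z − 1 ≥ 𝓛⁻⁸/2`
    have hzlo : (Skeleton.ell D ^ 8)⁻¹ / 2 ≤ z - 1 := by
      rw [hz, hlogP, div_sub_one (pow_ne_zero 9 hℓ0.ne'), le_div_iff₀ (pow_pos hℓ0 9)]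
      have h1 : Real.log (Skeleton.bigP D * Real.sqrt D) ≤ Real.log n := Real.log_le_log (by positivity) hnr
      rw [Real.log_mul hP0.ne' hsqD0.ne', hlogP, Real.log_sqrt hD0.le, hlogD] at h1
      have e : (Skeleton.ell D ^ 8)⁻¹ / 2 * Skeleton.ell D ^ 9 = Skeleton.ell D / 2 := by field_simp
      rw [e]; linarith
    -- `z ≤ 2`
    have hzhi : z ≤ 2 := by
      rw [hz, div_le_iff₀ (by rw [hlogP]; positivity), hlogP]
      have h1 : Real.log n ≤ Real.log (bandEdge D m) :=
        Real.log_le_log hn0 (by exact_mod_cast hn2.le)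
      have h2 := log_bandEdge_le hD3 m
      have hlog2 : Real.log 2 ≤ 1 := by have := Real.log_two_lt_d9; linarith
      have hlogℓ : Real.log (Skeleton.ell D) ≤ Skeleton.ell D :=
        (Real.log_le_sub_one_of_pos hℓ0).trans (by linarith)
      have hm0 : (0 : ℝ) ≤ m := Nat.cast_nonneg _
      -- `log 2 + 𝓛 + m log 𝓛 ≤ 𝓛⁹` for `𝓛 ≥ 8`: use `𝓛⁹ ≥ 𝓛²·𝓛 ≥ (m+2)·𝓛`? we only need a crude bound
      have h9 : 1 + Skeleton.ell D + (m : ℝ) * Skeleton.ell D ≤ Skeleton.ell D ^ 9 := by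
        have hm1 : (m : ℝ) + 1 ≤ Skeleton.ell D - 1 := by linarith
        have hA' : ((m : ℝ) + 1) * Skeleton.ell D ≤ (Skeleton.ell D - 1) * Skeleton.ell D :=
          mul_le_mul_of_nonneg_right hm1 hℓ0.le
        have hB' : Skeleton.ell D ^ 2 ≤ Skeleton.ell D ^ 9 := pow_le_pow_right₀ hℓ1.le (by norm_num)
        nlinarith
      nlinarith [mul_le_mul_of_nonneg_left hlogℓ hm0]
    have hz1 : 1 ≤ z := by have : (0:ℝ) < (Skeleton.ell D ^ 8)⁻¹ / 2 := by positivity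
                           linarith
    have hval : profCoef D wallTent n = ((z - 1 : ℝ) : ℂ) := by
      simp only [profCoef, ← hz]; exact wallTent_eq_of_mem hz1 hzhi
    rw [hval, Complex.norm_real, Real.norm_eq_abs, abs_of_nonneg (by linarith), div_eq_mul_inv]
    exact mul_le_mul_of_nonneg_right (pow_le_pow_left₀ (by positivity) hzlo 2) (inv_nonneg.mpr hn0.le)
  have hsum := Finset.sum_le_sum hpt
  refine le_trans ?_ hsum
  rw [← Finset.mul_sum]
  -- harmonic part: `Σ_{A ≤ n < bandEdge} 1/n ≥ log(bandEdge) − log A ≥ 𝓛/4`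
  have hharm : Skeleton.ell D / 4 ≤ ∑ n ∈ Finset.Ico A (bandEdge D m), (n : ℝ)⁻¹ := by
    refine le_trans ?_ (log_sub_log_le_sum_Ico_inv hA1 hAbe)
    have hbe0 : (0 : ℝ) < (bandEdge D m : ℕ) := by unfold bandEdge; push_cast; positivity
    have h1 : Real.log ((D : ℝ) * Skeleton.bigP D * Skeleton.ell D ^ m) ≤ Real.log (bandEdge D m) :=
      Real.log_le_log (by positivity) hbeR
    have h2 : Real.log A ≤ Real.log (2 * (Skeleton.bigP D * Real.sqrt D)) :=
      Real.log_le_log (by exact_mod_cast hA1) hAr'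
    rw [Real.log_mul (by positivity) (by positivity), Real.log_mul (by positivity) hP0.ne', hlogD, hlogP,
      Real.log_pow] at h1
    rw [Real.log_mul (by norm_num) (by positivity), Real.log_mul hP0.ne' hsqD0.ne', hlogP,
      Real.log_sqrt hD0.le, hlogD] at h2
    have hlog2 : Real.log 2 ≤ 1 := by have := Real.log_two_lt_d9; linarith
    have hmlog : 0 ≤ (m : ℝ) * Real.log (Skeleton.ell D) := mul_nonneg (Nat.cast_nonneg _) (Real.log_nonneg hℓ1.le)
    linarith
  have hc : (Skeleton.ell D ^ 15)⁻¹ / 16 = ((Skeleton.ell D ^ 8)⁻¹ / 2) ^ 2 * (Skeleton.ell D / 4) := by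
    field_simp; ring
  rw [hc]
  exact mul_le_mul_of_nonneg_left hharm (by positivity)

/-- **TIGHTNESS OF THE ROOM `𝓛⁶` (kernel companion of the reduction):** under the units nodes Prop 7.1, Lemma 8.1,
Prop 2.2 (i), Lemma 2.3 (`discWeight ≥ 2𝓛⁹𝔓`, p467613) and (A), for all large `D`, the right-hand side of
E-004′/E-004″ at `κ = 6` for the wall tent over the full band is at least `𝔓/8`:
`𝓛⁶ · discWeight · Σ_{⌈P⌉≤n<bandEdge}|g(z_n)|²/n ≥ 𝔓/8` — NOT `o(𝔞𝔓)` while `𝔞 = O(1)`. So the threshold `κ < 6` of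
`discMeanTrueBandAOn_wallZeroLip_of_bandMeanValueOn` is sharp for the method given only `𝔞 ≥ a₀` (more room only through
`log_𝓛 𝔞 ≤ 4`, `frakA_le_ell_pow_four`). [cite: Zhang2022LandauSiegel, §2 (2.16), (2.30)–(2.31); §7 Prop 7.1; §8 Lemma 8.1] -/
theorem bandMeanValue_rhs_at_six_ge (c' : ℝ) (m : ℕ) (h71 : Prop71 c') (h81 : Lemma81 c') (h22 : Prop22i)
    (h23 : Lemma23 c') :
    Skeleton.ForAllLarge fun D _ χ => Skeleton.AssumptionA D χ →
      frakP D / 8 ≤ Skeleton.ell D ^ (6 : ℝ) * discWeight c' χ *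
        coefBlockMass (profCoef D wallTent) ⌈Skeleton.bigP D⌉₊ (bandEdge D m) := by
  have hW := Skeleton.discWeight_trivialScale_window c' h71 h81 h22 h23
  refine ((hW.and (coefBlockMass_wallTent_ge m)).and (forAllLarge_three_le_and_le_ell 1)).mono ?_
  intro D _ χ _ _ h hAss
  obtain ⟨⟨hWD, hMD⟩, hD3, -⟩ := h
  have hℓ0 : 0 < Skeleton.ell D := zero_lt_one.trans (Skeleton.one_lt_ell hD3)
  have hfP : 0 ≤ frakP D := frakP_nonneg D
  have hlo : 2 * Skeleton.ell D ^ 9 * frakP D ≤ discWeight c' χ := (hWD hAss).1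
  have h6 : Skeleton.ell D ^ (6 : ℝ) = Skeleton.ell D ^ 6 := by
    rw [show (6 : ℝ) = ((6 : ℕ) : ℝ) by norm_num, Real.rpow_natCast]
  rw [h6]
  calc frakP D / 8 = Skeleton.ell D ^ 6 * (2 * Skeleton.ell D ^ 9 * frakP D) * ((Skeleton.ell D ^ 15)⁻¹ / 16) := by
        field_simp; ring
    _ ≤ Skeleton.ell D ^ 6 * discWeight c' χ * ((Skeleton.ell D ^ 15)⁻¹ / 16) :=
        mul_le_mul_of_nonneg_right (mul_le_mul_of_nonneg_left hlo (by positivity)) (by positivity)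
    _ ≤ Skeleton.ell D ^ 6 * discWeight c' χ *
          coefBlockMass (profCoef D wallTent) ⌈Skeleton.bigP D⌉₊ (bandEdge D m) :=
        mul_le_mul_of_nonneg_left hMD (mul_nonneg (by positivity) (discWeight_nonneg_aux c' χ))

end Repair

end Literature.NumberTheory.LFunctions.Zhang2022
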